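import Summits.CriticalPhenomena.PercolationContinuityZ3.Theses.PercNearOneGluing
import Summits.CriticalPhenomena.PercolationContinuityZ3.Theorems.PercNearOneGluingAdditiveGluingObsLemma4Mult
import Summits.CriticalPhenomena.PercolationContinuityZ3.Theorems.PercNearOneGluingAdditiveGluingML5DriverTools

/-!
# Crux `PercNearOneGluing.AdditiveGluing` (stmt-CriticalPhenomena-4576), line `tieline`: ML5 ⟹ K₀

The kernel actually consumed by the landed two-step three-relay reduction
(`threeRelaysFullTieAllBad_of_k0`, registered stub `stub_k0_dp`) is the **slack-inheritance kernel (K₀)**: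
`μ(N ∩ {o ↔ c})·(G_{a₂} − G_c) ≤ μ(N)·(G_{a₂} − G_o)` for the weaker relay `a₂` (`τ_{a₂} ≤ τ_{a₁}`),
`N = {c ↮ a₁} ∩ {c ↮ a₂}`, `G_{a₂} = μ(a₁↔b ∪ a₂↔b) − τ_{a₂}`, `G_x` = exact pair-gluing gain of `x`.
This file records that (K₀) is WEAKER than the one-weight mixture lemma ML5 (registered stub `stub_ml5_c9`, which the
landed driver `ml5_of_F2_TLIH` derives from F2 + TL'): since `N ∩ {o ↔ c} ⊆ N ∩ O_Aᶜ` and `G_c ≤ G_{a₂}`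
(Kozma–Nitzan's Lemma 4 for the observer `c`, landed as `stub_obsLemma4Mult_c8`), ML5
`μ(N)G_o ≤ μ(N ∩ O_A)G_{a₂} + μ(N ∩ O_Aᶜ)G_c` gives `μ(N)(G_{a₂} − G_o) ≥ μ(N ∩ O_Aᶜ)(G_{a₂} − G_c) ≥ μ(N ∩ {o↔c})(G_{a₂} − G_c)`.
[cite: KozmaNitzan2024, Lemma 4 / eq. (8)–(9) (pp. 9–10), Question 7 (p. 36)]
-/

namespace Summit.CriticalPhenomena.PercolationContinuityZ3.Cruxes.AdditiveGluing.TieLine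

open MeasureTheory Set Literature.Probability.LatticeModels Literature.Probability.Percolation
open Summit.CriticalPhenomena.PercolationContinuityZ3.Theorems

namespace K0OfML5

variable {n : ℕ}

/-- `N ∩ {o ↔ c} ⊆ N ∩ O_Aᶜ`: if `o ↔ c` and `c ↮ a₁, a₂` then `o ↮ a₁, a₂`. [folklore] -/
theorem inter_openConn_subset (w : Sym2 (Fin n) → unitInterval) (o c a₁ a₂ : Fin n) :
    (prodBernoulli w).real ((openConn c a₁)ᶜ ∩ (openConn c a₂)ᶜ ∩ openConn o c : Set (BondConfig (Fin n))) ≤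
      (prodBernoulli w).real ((openConn c a₁)ᶜ ∩ (openConn c a₂)ᶜ ∩ (openConn o a₁ ∪ openConn o a₂)ᶜ : Set (BondConfig (Fin n))) := by
  refine measureReal_mono ?_ (measure_ne_top _ _)
  rintro ω ⟨⟨h1, h2⟩, hoc⟩
  simp only [mem_inter_iff, mem_compl_iff, mem_union, openConn, mem_setOf_eq] at h1 h2 hoc ⊢
  exact ⟨⟨h1, h2⟩, fun h => h.elim (fun ho => h1 (hoc.symm.trans ho)) (fun ho => h2 (hoc.symm.trans ho))⟩

/-- `G_c ≤ G_{a₂}` for the weaker relay `a₂` (`τ_{a₂} ≤ τ_{a₁}`): Kozma–Nitzan's Lemma 4 for the observer `c`, from the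
landed multiplicative form `stub_obsLemma4Mult_c8`. [cite: KozmaNitzan2024, Lemma 4 (p. 9)] -/
theorem gain_le_gainMax (w : Sym2 (Fin n) → unitInterval) (b a₁ a₂ c : Fin n)
    (hτ : (prodBernoulli w).real (openConn a₂ b : Set (BondConfig (Fin n))) ≤ (prodBernoulli w).real (openConn a₁ b)) :
    (prodBernoulli w).real ((openConn c b)ᶜ ∩ (openConn c a₁ ∪ openConn c a₂) ∩ (openConn a₁ b ∪ openConn a₂ b) : Set (BondConfig (Fin n))) ≤
      (prodBernoulli w).real (openConn a₁ b ∪ openConn a₂ b : Set (BondConfig (Fin n))) - (prodBernoulli w).real (openConn a₂ b : Set (BondConfig (Fin n))) := by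
  have hm : ∀ s : Set (BondConfig (Fin n)), MeasurableSet s := fun _ => MeasurableSet.of_discrete
  -- `μ(a₁↔b ∪ a₂↔b) − τ_{a₂} = μ({a₂ ↮ b} ∩ {a₁ ↔ b})`
  have hGu : (prodBernoulli w).real (openConn a₁ b ∪ openConn a₂ b : Set (BondConfig (Fin n))) -
      (prodBernoulli w).real (openConn a₂ b : Set (BondConfig (Fin n))) =
      (prodBernoulli w).real ((openConn a₂ b)ᶜ ∩ openConn a₁ b : Set (BondConfig (Fin n))) := by
    rw [Set.union_comm]
    exact (ML5Driver.real_Gu_eq w b a₂ a₁).symm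
  rw [hGu]
  by_cases h12 : a₁ = a₂
  · subst h12
    have h0 : ((openConn c b)ᶜ ∩ (openConn c a₁ ∪ openConn c a₁) ∩ (openConn a₁ b ∪ openConn a₁ b) : Set (BondConfig (Fin n))) = ∅ := by
      ext ω
      simp only [mem_inter_iff, mem_compl_iff, mem_union, openConn, mem_setOf_eq, mem_empty_iff_false, iff_false, or_self]
      rintro ⟨⟨hcb, hca⟩, hab⟩
      exact hcb (hca.trans hab)
    rw [h0, measureReal_empty]
    exact measureReal_nonneg
  -- KN Lemma 4 (multiplicative form) with observer `c`, weaker relay `a₂`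
  have key := stub_obsLemma4Mult_c8 n w c b a₂ a₁ (Ne.symm h12) hτ
  have hev : ((openConn c b)ᶜ ∩ (openConn c a₂ ∪ openConn c a₁) ∩ (openConn a₂ b ∪ openConn a₁ b) : Set (BondConfig (Fin n))) =
      ((openConn c b)ᶜ ∩ (openConn c a₁ ∪ openConn c a₂) ∩ (openConn a₁ b ∪ openConn a₂ b) : Set (BondConfig (Fin n))) := by
    rw [Set.union_comm (openConn c a₂), Set.union_comm (openConn a₂ b)]
  rw [hev] at key
  have hD : (prodBernoulli w).real ((openConn a₂ a₁)ᶜ ∩ (openConn c a₂ ∪ openConn c a₁) : Set (BondConfig (Fin n))) ≤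
      (prodBernoulli w).real ((openConn a₂ a₁)ᶜ : Set (BondConfig (Fin n))) :=
    measureReal_mono Set.inter_subset_left (measure_ne_top _ _)
  have hG : 0 ≤ (prodBernoulli w).real ((openConn a₂ b)ᶜ ∩ openConn a₁ b : Set (BondConfig (Fin n))) := measureReal_nonneg
  by_cases hpos : 0 < (prodBernoulli w).real ((openConn a₂ a₁)ᶜ : Set (BondConfig (Fin n)))
  · have k2 := le_trans key (mul_le_mul_of_nonneg_right hD hG)
    exact le_of_mul_le_mul_left k2 hpos
  · -- `μ(a₂ ↮ a₁) = 0`: the gain event forces `a₁ ↮ a₂`, so it is null as well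
    have hz : (prodBernoulli w).real ((openConn a₂ a₁)ᶜ : Set (BondConfig (Fin n))) = 0 :=
      le_antisymm (not_lt.1 hpos) measureReal_nonneg
    have hsub := ObsLemma4Mult.gain_subset_compl c b a₁ a₂ (V := Fin n)
    have h1 : (prodBernoulli w).real ((openConn c b)ᶜ ∩ (openConn c a₁ ∪ openConn c a₂) ∩ (openConn a₁ b ∪ openConn a₂ b) : Set (BondConfig (Fin n))) ≤
        (prodBernoulli w).real ((openConn a₂ a₁)ᶜ : Set (BondConfig (Fin n))) := by
      refine measureReal_mono (hsub.trans ?_) (measure_ne_top _ _)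
      intro ω hω h
      exact hω ((show (openGraph ω).Reachable a₂ a₁ from h).symm)
    linarith

end K0OfML5

open K0OfML5 in
/-- **ML5 ⟹ (K₀)**: the one-weight mixture lemma (registered stub `stub_ml5_c9`) implies the slack-inheritance
kernel (K₀) (registered stub `stub_k0_dp`, the hypothesis of the landed `threeRelaysFullTieAllBad_of_k0`).  Hence the
line's chain F2 + TL' ⟹ ML5 (`ml5_of_F2_TLIH`) also closes (K₀).
[cite: KozmaNitzan2024, Lemma 4 / eq. (8)–(9) (pp. 9–10), Question 7 (p. 36)] -/
theorem k0_of_ml5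
    (hML5 : ∀ (n : ℕ) (w : Sym2 (Fin n) → unitInterval) (o b a₁ a₂ c : Fin n),
      (prodBernoulli w).real ((openConn c a₁)ᶜ ∩ (openConn c a₂)ᶜ : Set (BondConfig (Fin n))) *
          (prodBernoulli w).real ((openConn o b)ᶜ ∩ (openConn o a₁ ∪ openConn o a₂) ∩ (openConn a₁ b ∪ openConn a₂ b)) ≤
        (prodBernoulli w).real ((openConn c a₁)ᶜ ∩ (openConn c a₂)ᶜ ∩ (openConn o a₁ ∪ openConn o a₂)) *
            ((prodBernoulli w).real (openConn a₁ b ∪ openConn a₂ b) -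
              min ((prodBernoulli w).real (openConn a₁ b)) ((prodBernoulli w).real (openConn a₂ b))) +
          (prodBernoulli w).real ((openConn c a₁)ᶜ ∩ (openConn c a₂)ᶜ ∩ (openConn o a₁ ∪ openConn o a₂)ᶜ) *
            (prodBernoulli w).real ((openConn c b)ᶜ ∩ (openConn c a₁ ∪ openConn c a₂) ∩ (openConn a₁ b ∪ openConn a₂ b))) :
∀ (n : ℕ) (w : Sym2 (Fin n) → unitInterval) (o b a₁ a₂ c : Fin n), (Literature.Probability.LatticeModels.prodBernoulli w).real (Literature.Probability.Percolation.openConn a₂ b) ≤ (Literature.Probability.LatticeModels.prodBernoulli w).real (Literature.Probability.Percolation.openConn a₁ b) → (Literature.Probability.LatticeModels.prodBernoulli w).real ((Literature.Probability.Percolation.openConn c a₁)ᶜ ∩ (Literature.Probability.Percolation.openConn c a₂)ᶜ ∩ Literature.Probability.Percolation.openConn o c) * ((Literature.Probability.LatticeModels.prodBernoulli w).real (Literature.Probability.Percolation.openConn a₁ b ∪ Literature.Probability.Percolation.openConn a₂ b) - (Literature.Probability.LatticeModels.prodBernoulli w).real (Literature.Probability.Percolation.openConn a₂ b) - (Literature.Probability.LatticeModels.prodBernoulli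 w).real ((Literature.Probability.Percolation.openConn c b)ᶜ ∩ (Literature.Probability.Percolation.openConn c a₁ ∪ Literature.Probability.Percolation.openConn c a₂) ∩ (Literature.Probability.Percolation.openConn a₁ b ∪ Literature.Probability.Percolation.openConn a₂ b))) ≤ (Literature.Probability.LatticeModels.prodBernoulli w).real ((Literature.Probability.Percolation.openConn c a₁)ᶜ ∩ (Literature.Probability.Percolation.openConn c a₂)ᶜ : Set (Literature.Probability.Percolation.BondConfig (Fin n))) * ((Literature.Probability.LatticeModels.prodBernoulli w).real (Literature.Probability.Percolation.openConn a₁ b ∪ Literature.Probability.Percolation.openConn a₂ b) - (Literature.Probability.LatticeModels.prodBernoulli w).real (Literature.Probability.Percolation.openConn a₂ b) - (Literature.Probability.LatticeModels.prodBernoulli w).real ((Literature.Probability.Percolation.openConn o b)ᶜ ∩ (Literature.Probability.Percolation.openConn o a₁ ∪ Literature.Probability.Percolation.openConn o a₂) ∩ (Literature.Probability.Percolation.openConn a₁ b ∪ Literature.Probability.Percolation.openConn a₂ b))) := by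
  intro n w o b a₁ a₂ c hτ
  have h := hML5 n w o b a₁ a₂ c
  rw [min_eq_right hτ] at h
  have hN := ML5Driver.real_N_eq w o a₁ a₂ c
  have hβ := inter_openConn_subset w o c a₁ a₂
  have hG := gain_le_gainMax w b a₁ a₂ c hτ
  have hβ0 : 0 ≤ (prodBernoulli w).real ((openConn c a₁)ᶜ ∩ (openConn c a₂)ᶜ ∩ openConn o c : Set (BondConfig (Fin n))) :=
    measureReal_nonneg
  rw [hN] at h ⊢
  nlinarith [mul_le_mul_of_nonneg_right hβ (sub_nonneg.2 hG), h, hβ0]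

end Summit.CriticalPhenomena.PercolationContinuityZ3.Cruxes.AdditiveGluing.TieLine
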